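import Summits.MatrixMultiplication.OmegaCensus.STPP222IcosetHSearch
import Mathlib.Tactic.IntervalCases
import Summits.MatrixMultiplication.OmegaCensus.STPP222IcosetClassNoneK6Z11C1

/-!
# ω-census, icoset class negatives: kernel evaluation chunks for `𝔽₂³ × ℤ₁₁`, `K = 6` (part C2: `b₁ = 3`, `c₁ ∈ {6,…,10}`; and the `b₁ = 3` summary)

HONEST FRAMING (pub-omega census; verbatim): lottery ticket; floor = certified bounds/negative ranges.
Census STRUCTURE bookkeeping (Q7), nothing about `ω`.  Pure kernel evaluations of `IcosetH.checkFrom (cyc 11) 6 x y` (the subtree of the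
H-stage search below the level-1 choice `(b₁, c₁) = (x, y)`; engine `STPP222IcosetHSearch.lean`, soundness `STPP222IcosetHSearchSound.lean`),
one `decide +kernel` per `(x, y)` with ≥ 300 search nodes, light ones grouped; the parts are assembled into `IcosetH.check (cyc 11) 6 = true`
and the class negative in `STPP222IcosetClassNoneK6Z11.lean`.  Node counts (seat prototype = ENG2 icoset3; 151 112 in all; ≈ 8 ms/node on the
farm): (3,6): 2532, (3,7): 2193, (3,8): 2532, (3,9): 2748, (3,10): 2987 — this file 12992 nodes.  Seat pub-omega-kernel-l4 (gen 19), 2026-08-27.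
-/

namespace Summit.MatrixMultiplication.OmegaCensus

namespace IcosetH

/-- Kernel evaluation of the `(b₁, c₁) = (3, 6)` subtree (2532 nodes). -/
theorem checkFrom_cyc11_3_6 : checkFrom (cyc 11) 6 3 6 = true := by decide +kernel

/-- Kernel evaluation of the `(b₁, c₁) = (3, 7)` subtree (2193 nodes). -/
theorem checkFrom_cyc11_3_7 : checkFrom (cyc 11) 6 3 7 = true := by decide +kernel

/-- Kernel evaluation of the `(b₁, c₁) = (3, 8)` subtree (2532 nodes). -/
theorem checkFrom_cyc11_3_8 : checkFrom (cyc 11) 6 3 8 = true := by decide +kernel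

/-- Kernel evaluation of the `(b₁, c₁) = (3, 9)` subtree (2748 nodes). -/
theorem checkFrom_cyc11_3_9 : checkFrom (cyc 11) 6 3 9 = true := by decide +kernel

/-- Kernel evaluation of the `(b₁, c₁) = (3, 10)` subtree (2987 nodes). -/
theorem checkFrom_cyc11_3_10 : checkFrom (cyc 11) 6 3 10 = true := by decide +kernel

/-- All level-1 choices `c₁ = y` below `b₁ = 3` are refuted (heavy `y` from the part files, light ones evaluated here). -/
theorem checkFrom_cyc11_3 : ∀ y, y < 11 → checkFrom (cyc 11) 6 3 y = true := by
  intro y hy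
  interval_cases y
  exacts [by decide +kernel, checkFrom_cyc11_3_1, checkFrom_cyc11_3_2, by decide +kernel, checkFrom_cyc11_3_4, checkFrom_cyc11_3_5, checkFrom_cyc11_3_6, checkFrom_cyc11_3_7, checkFrom_cyc11_3_8, checkFrom_cyc11_3_9, checkFrom_cyc11_3_10]

end IcosetH

end Summit.MatrixMultiplication.OmegaCensus
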